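import Literature.Geometry.Symplectic.OrigamiNullFoliation
import Literature.Geometry.Kaehler.ManifoldFormsChart
import HarnessLib

/-!
# First-order analysis of the collar of a fold — calculus lemmas and the product chart of `N × ℝ`

Proofs companion of `OrigamiUnfolding.lean` (the named fact
`Literature.Geometry.Symplectic.exists_symplecticCutPieces_of_isOrigamiForm`, Cannas da
Silva–Guillemin–Pires, *Symplectic Origami*, IMRN 2011 = arXiv:0909.4065, Prop. 2.8; architecture
in `OrigamiUnfoldingProofs.lean`), preparing step (S1b): on the kernel-adapted collar
`c : N × (-δ, δ) → M` of the fold (`OrigamiFoldCollar.lean`) the pulled-back form is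
`c^*ω = A_t + dt ∧ B_t` with `A₀ = j^*ω`, `B₀ = 0`, and the Moser model of the proof of
Prop. 2.8 is governed by the first-order coefficient `B₁ = ∂ₜ|₀ B_t`, whose value on the null
direction `X` does not vanish (transversality `ω ∧ ω ⋔ 0` read along the flow lines).  The
proof of that non-vanishing (next file) differentiates, at `t = 0`, the Pfaffian of
`(c^*ω)_{(n,t)}` in a frame adapted to `X` and compares it with the chart Pfaffian through a
continuous non-vanishing determinant.  This file supplies the generic ingredients:

* `hasDerivAt_pfaffCombination` — if `P = a₁₂a₃₄ - a₁₃a₂₄ + a₁₄a₂₃` with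
  `a₁₃(0) = a₂₃(0) = a₁₄(0) = a₂₄(0) = a₃₄(0) = 0` then `P'(0) = a₁₂(0) a₃₄'(0)`;
* `hasDerivAt_ne_zero_of_eq_mul` — if `P = d · g` near `0` with `d` continuous, `d(0) ≠ 0`,
  `g(0) = 0`, `g'(0) ≠ 0`, then `P'(0) ≠ 0`;
* the product chart of `N × ℝ` (model `(𝓡 3).prod 𝓘(ℝ, ℝ)`): `extChartAt_prod_real_eq` — the
  extended chart at `(n, t)` IS the one at `(n, 0)` (definitionally: the chart of `ℝ` at `t` is
  the identity), `inChart_prod_real_eq`, `extChartAt_prod_real_apply`,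
  `apply_eq_inChart_zero` (`Ω_{(n,t)} = Ω.inChart (n,0) (φ_n n, t)` for every `t`), and
  **`contDiff_apply_prod_real`**: for a smooth `2`-form `Ω` on `N × ℝ` and fixed coordinate
  vectors `W₁, W₂`, the function `t ↦ Ω_{(n,t)}(W₁, W₂)` is `C^∞` on `ℝ` — which makes the
  coefficients `A_t`, `B_t` of `c^*ω` and `B₁ = ∂ₜ|₀ B_t` meaningful without any chart on the
  collar.

Everything here is proved; no definitions, no named facts (D-0026).

## References

* [CannasdasilvaGuilleminPires2010] A. Cannas da Silva, V. Guillemin, A. R. Pires, *Symplectic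
  Origami*, IMRN 2011, 4252–4293 = arXiv:0909.4065, proof of Prop. 2.8 (Moser model
  `p^*i^*ω + d(t² p^*α)`).
* A. Cannas da Silva, V. Guillemin, C. Woodward, *On the unfolding of folded symplectic
  structures*, Math. Res. Lett. 7 (2000) 35–53, Thm. 1.
-/

noncomputable section

open scoped Manifold ContDiff Topology
open Set Function Filter
open Literature.Geometry.Kaehler

namespace Literature.Geometry.Symplectic

/-! ### One-variable calculus of the Pfaffian combination -/

/-- **Derivative of a Pfaffian-type combination at a degenerate point.** If
`P = a₁₂ a₃₄ - a₁₃ a₂₄ + a₁₄ a₂₃` with all six functions differentiable at `0` and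
`a₁₃(0) = a₂₃(0) = a₁₄(0) = a₂₄(0) = a₃₄(0) = 0`, then `P'(0) = a₁₂(0) · a₃₄'(0)`. [folklore] -/
theorem hasDerivAt_pfaffCombination {a₁₂ a₁₃ a₁₄ a₂₃ a₂₄ a₃₄ : ℝ → ℝ}
    {d₁₂ d₁₃ d₁₄ d₂₃ d₂₄ d₃₄ : ℝ}
    (h₁₂ : HasDerivAt a₁₂ d₁₂ 0) (h₁₃ : HasDerivAt a₁₃ d₁₃ 0) (h₁₄ : HasDerivAt a₁₄ d₁₄ 0)
    (h₂₃ : HasDerivAt a₂₃ d₂₃ 0) (h₂₄ : HasDerivAt a₂₄ d₂₄ 0) (h₃₄ : HasDerivAt a₃₄ d₃₄ 0)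
    (z₁₃ : a₁₃ 0 = 0) (z₂₃ : a₂₃ 0 = 0) (z₁₄ : a₁₄ 0 = 0) (z₂₄ : a₂₄ 0 = 0) (z₃₄ : a₃₄ 0 = 0) :
    HasDerivAt (fun t => a₁₂ t * a₃₄ t - a₁₃ t * a₂₄ t + a₁₄ t * a₂₃ t) (a₁₂ 0 * d₃₄) 0 := by
  have h := ((h₁₂.mul h₃₄).sub (h₁₃.mul h₂₄)).add (h₁₄.mul h₂₃)
  have e : d₁₂ * a₃₄ 0 + a₁₂ 0 * d₃₄ - (d₁₃ * a₂₄ 0 + a₁₃ 0 * d₂₄) + (d₁₄ * a₂₃ 0 + a₁₄ 0 * d₂₃) =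
      a₁₂ 0 * d₃₄ := by
    rw [z₁₃, z₂₃, z₁₄, z₂₄, z₃₄]; ring
  exact e ▸ h

/-- **Non-vanishing transfer through a non-vanishing continuous factor.** If `P = d · g` near
`0`, `d` is continuous at `0` with `d 0 ≠ 0`, `g 0 = 0` and `g` has non-zero derivative at `0`,
then any derivative of `P` at `0` is non-zero (`P(t)/t → d(0) g'(0)`). [folklore] -/
theorem hasDerivAt_ne_zero_of_eq_mul {P d g : ℝ → ℝ} {p g' : ℝ}
    (hP : HasDerivAt P p 0) (heq : ∀ᶠ t in 𝓝 (0 : ℝ), P t = d t * g t)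
    (hd : ContinuousAt d 0) (hd0 : d 0 ≠ 0) (hg0 : g 0 = 0) (hg : HasDerivAt g g' 0)
    (hg' : g' ≠ 0) : p ≠ 0 := by
  -- `P 0 = 0`
  have hP0 : P 0 = 0 := by rw [heq.self_of_nhds, hg0, mul_zero]
  -- slopes: `P t / t = d t * (g t / t) → d 0 * g'`
  have hslopeP : Tendsto (fun t => t⁻¹ * P t) (𝓝[≠] 0) (𝓝 p) := by
    have := hasDerivAt_iff_tendsto_slope_zero.1 hP
    simpa [hP0] using this
  have hslopeg : Tendsto (fun t => t⁻¹ * g t) (𝓝[≠] 0) (𝓝 g') := by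
    have := hasDerivAt_iff_tendsto_slope_zero.1 hg
    simpa [hg0] using this
  have hd' : Tendsto d (𝓝[≠] 0) (𝓝 (d 0)) := hd.tendsto.mono_left nhdsWithin_le_nhds
  have hprod : Tendsto (fun t => d t * (t⁻¹ * g t)) (𝓝[≠] 0) (𝓝 (d 0 * g')) := hd'.mul hslopeg
  have hev : (fun t => t⁻¹ * P t) =ᶠ[𝓝[≠] (0 : ℝ)] fun t => d t * (t⁻¹ * g t) := by
    filter_upwards [mem_nhdsWithin_of_mem_nhds heq] with t ht
    rw [ht]; ring
  have hlim : Tendsto (fun t => t⁻¹ * P t) (𝓝[≠] 0) (𝓝 (d 0 * g')) := hprod.congr' hev.symm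
  have huniq : p = d 0 * g' := tendsto_nhds_unique hslopeP hlim
  rw [huniq]
  exact mul_ne_zero hd0 hg'

/-! ### Forms on `N × ℝ`: the chart at `(n, t)` does not depend on `t` -/

section ProductChart

variable {N : Type*} [TopologicalSpace N] [ChartedSpace (EuclideanSpace ℝ (Fin 3)) N]

/-- On `N × ℝ` the preferred extended chart at `(n, t)` does not depend on `t`. [folklore] -/
theorem extChartAt_prod_real_eq (n : N) (t : ℝ) :
    extChartAt ((𝓡 3).prod 𝓘(ℝ, ℝ)) ((n, t) : N × ℝ) =
      extChartAt ((𝓡 3).prod 𝓘(ℝ, ℝ)) ((n, (0 : ℝ)) : N × ℝ) := rfl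

/-- Hence the chart representative of a form on `N × ℝ` at `(n, t)` is the one at `(n, 0)`
(definitionally). [folklore] -/
theorem inChart_prod_real_eq (Ω : MForm ((𝓡 3).prod 𝓘(ℝ, ℝ)) (N × ℝ) ℝ 2) (n : N) (t : ℝ) :
    Ω.inChart (n, t) = Ω.inChart (n, (0 : ℝ)) := rfl

/-- The value of the extended chart of `N × ℝ` at `(n, t)`. [folklore] -/
theorem extChartAt_prod_real_apply (n n' : N) (t t' : ℝ) :
    extChartAt ((𝓡 3).prod 𝓘(ℝ, ℝ)) ((n, t) : N × ℝ) (n', t') = (extChartAt (𝓡 3) n n', t') := by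
  rw [extChartAt_prod]
  rfl

variable [IsManifold (𝓡 3) ∞ N]

/-- **A form on `N × ℝ` read in the chart at `(n, 0)` along the line over `n`**: for every `t`,
`Ω (n, t) = Ω.inChart (n, 0) (φ_n n, t)`. [folklore] -/
theorem apply_eq_inChart_zero (Ω : MForm ((𝓡 3).prod 𝓘(ℝ, ℝ)) (N × ℝ) ℝ 2) (n : N) (t : ℝ) :
    Ω (n, t) = Ω.inChart (n, (0 : ℝ)) (extChartAt (𝓡 3) n n, t) := by
  have h := (MForm.inChart_apply_self Ω ((n, t) : N × ℝ)).symm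
  rw [inChart_prod_real_eq Ω n t, extChartAt_prod_real_apply] at h
  exact h

/-- **Smoothness in `t` of a smooth form on `N × ℝ` evaluated on fixed coordinate vectors**:
`t ↦ Ω_{(n,t)}(W₁, W₂)` is `C^∞` on `ℝ` (it is the smooth chart representative at `(n, 0)` read
along the line `t ↦ (φ_n n, t)` of its chart target). [folklore] -/
theorem contDiff_apply_prod_real {Ω : MForm ((𝓡 3).prod 𝓘(ℝ, ℝ)) (N × ℝ) ℝ 2}
    (hΩ : IsSmoothForm Ω) (n : N) (W : Fin 2 → EuclideanSpace ℝ (Fin 3) × ℝ) :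
    ContDiff ℝ ∞ fun t : ℝ => Ω (n, t) W := by
  have hrep : ContDiffOn ℝ ∞ (Ω.inChart ((n, (0 : ℝ)) : N × ℝ))
      (extChartAt ((𝓡 3).prod 𝓘(ℝ, ℝ)) ((n, (0 : ℝ)) : N × ℝ)).target :=
    Literature.Geometry.Kaehler.IsSmoothForm.contDiffOn_inChart hΩ _
  have htgt : ∀ t : ℝ, (extChartAt (𝓡 3) n n, t) ∈
      (extChartAt ((𝓡 3).prod 𝓘(ℝ, ℝ)) ((n, (0 : ℝ)) : N × ℝ)).target := by
    intro t
    rw [extChartAt_prod, PartialEquiv.prod_target]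
    exact ⟨mem_extChartAt_target n, by simp⟩
  have hline : ContDiff ℝ ∞ fun t : ℝ => ((extChartAt (𝓡 3) n n, t) : EuclideanSpace ℝ (Fin 3) × ℝ) :=
    contDiff_const.prodMk contDiff_id
  have hcomp : ContDiff ℝ ∞ fun t : ℝ => Ω.inChart ((n, (0 : ℝ)) : N × ℝ) (extChartAt (𝓡 3) n n, t) := by
    rw [contDiff_iff_contDiffAt]
    intro t
    have hopen : IsOpen (extChartAt ((𝓡 3).prod 𝓘(ℝ, ℝ)) ((n, (0 : ℝ)) : N × ℝ)).target :=
      isOpen_extChartAt_target _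
    exact (hrep.contDiffAt (hopen.mem_nhds (htgt t))).comp t hline.contDiffAt
  have heval : ContDiff ℝ ∞ fun α : (EuclideanSpace ℝ (Fin 3) × ℝ) [⋀^Fin 2]→L[ℝ] ℝ => α W := by
    have h : IsBoundedLinearMap ℝ fun α : (EuclideanSpace ℝ (Fin 3) × ℝ) [⋀^Fin 2]→L[ℝ] ℝ => α W := by
      refine ⟨⟨fun a b => rfl, fun c a => rfl⟩, (∏ i, ‖W i‖) + 1, by positivity, fun α => ?_⟩
      calc ‖α W‖ ≤ ‖α‖ * ∏ i, ‖W i‖ := α.le_opNorm W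
        _ ≤ ((∏ i, ‖W i‖) + 1) * ‖α‖ := by
          nlinarith [norm_nonneg α,
            Finset.prod_nonneg fun i (_ : i ∈ Finset.univ) => norm_nonneg (W i)]
    exact h.contDiff
  have hfun : (fun t : ℝ => Ω (n, t) W) =
      (fun α : (EuclideanSpace ℝ (Fin 3) × ℝ) [⋀^Fin 2]→L[ℝ] ℝ => α W) ∘
        fun t : ℝ => Ω.inChart ((n, (0 : ℝ)) : N × ℝ) (extChartAt (𝓡 3) n n, t) := by
    funext t
    simp only [Function.comp_apply]
    rw [apply_eq_inChart_zero Ω n t]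
    rfl
  rw [hfun]
  exact heval.comp hcomp

end ProductChart

end Literature.Geometry.Symplectic

end
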